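import Summits.KontsevichZagierPeriods.Zeta5Search.TwoTaleP15LineBoundRate
import Summits.KontsevichZagierPeriods.Zeta5Search.Denom.TwoTaleP15LineRep

/-!
# The two-tale point P15: `Decay c` from a one-variable certificate

HONEST FRAMING: systematic search; no irrationality claim unless certified.

Cell pub-zeta5, T3 service (P1 g9) — E5 of `families/denom/P15KERNEL.md` §6 reduced to its numerical core.  With
fam-denom's `decay_of_halfLineBound` (line representation + strip shift PROVED) and this seat's scaled line bound
`log_norm_ratRC_line_le`, the decay input of the T3 chain at P15 follows from ONE explicit inequality for the elementary
function `rateG` (sums of `V·½log(V²+η²) − V + η·arctan(V/η)` at eight rational `V`, plus constants):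

* `lineIntegrand_le` — pointwise on the line `x = ⌊26n/5⌋ + ½`, for `y ≠ 0`:
  `‖R_n(uₙ+iy)‖/cosh²(πy) ≤ 4e^{K₀}·n²·(484+y²)⁹·e^{nM}·e^{−δ|y|}` whenever `rateG η − (2π−δ)|η| ≤ M` for all `η ≠ 0`;
* `integrable_poly_exp` — `(484+y²)⁹e^{−δ|y|}` is integrable (`(22+|y|)¹⁸ ≤ 18!(2/δ)¹⁸ e^{(δ/2)(22+|y|)}`);
* **`decay_of_certificate`**: `0 < δ` → `(∀ η ≠ 0, rateG η − (2π − δ)|η| ≤ M)` → `c < −M` → `Denom.TwoTaleP15Forms.Decay c`.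
The certificate itself (numerically `max_η (rateG η − 2π|η|) = −29.1079` at `η ≈ 2.15`, so any `M > −29.1079 + δ·2.2`
works; a record needs `c > 28.95`) is NOT proved here.
-/

noncomputable section

open Real Complex MeasureTheory Set Filter

namespace Summit.KontsevichZagierPeriods.Zeta5Search.TwoTaleLineBound

open Denom.TwoTaleP15Decay (ratRC)

/-- `cosh² x ≥ e^{2|x|}/4`. -/
theorem exp_le_cosh_sq (x : ℝ) : Real.exp (2 * |x|) / 4 ≤ Real.cosh x ^ 2 := by
  rw [Real.cosh_eq]
  have h1 : Real.exp |x| ≤ Real.exp x + Real.exp (-x) := by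
    rcases le_or_gt 0 x with h | h
    · rw [abs_of_nonneg h]; linarith [Real.exp_pos (-x)]
    · rw [abs_of_neg h]; linarith [Real.exp_pos x]
  have h2 : Real.exp (2 * |x|) = Real.exp |x| ^ 2 := by rw [← Real.exp_nat_mul]; norm_num
  rw [h2]
  have h3 : 0 ≤ Real.exp |x| := (Real.exp_pos _).le
  nlinarith [h1, h3, Real.exp_pos x, Real.exp_pos (-x)]

/-- The constant `K₀ = 12|log(3/10)| + 3(1+log 2) + 1` of `log_norm_ratRC_line_le`. -/
def K0 : ℝ := 12 * |Real.log (3 / 10)| + 3 * (1 + Real.log 2) + 1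

variable {M δ : ℝ}

/-- **Pointwise bound on the line** (`y ≠ 0`, `n ≥ 1`), given the certificate with slope `2π − δ`. -/
theorem lineIntegrand_le (hcert : ∀ η : ℝ, η ≠ 0 → rateG η - (2 * π - δ) * |η| ≤ M) {n : ℕ} (hn : 1 ≤ n)
    {y : ℝ} (hy : y ≠ 0) :
    ‖ratRC n ((uLine n : ℂ) + (y : ℂ) * I)‖ / Real.cosh (π * y) ^ 2 ≤
      4 * Real.exp K0 * (n : ℝ) ^ 2 * (484 + y ^ 2) ^ 9 * Real.exp (n * M) * Real.exp (-(δ * |y|)) := by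
  have hn0 : (0 : ℝ) < n := by exact_mod_cast hn
  have hn1 : (1 : ℝ) ≤ n := by exact_mod_cast hn
  obtain ⟨η, hη⟩ : ∃ η : ℝ, η = y / n := ⟨_, rfl⟩
  have hη0 : η ≠ 0 := by rw [hη]; exact div_ne_zero hy hn0.ne'
  have hyη : (n : ℝ) * η = y := by rw [hη]; field_simp
  have hL := log_norm_ratRC_line_le hη0 hn
  rw [show ((((n : ℝ) * η : ℝ) : ℂ)) = (y : ℂ) by rw [hyη]] at hL
  have hc := hcert η hη0
  -- scale the certificate: n·rateG η ≤ n M + (2π − δ)|y|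
  have habs : (n : ℝ) * |η| = |y| := by rw [← abs_of_pos hn0, ← abs_mul, hyη]
  have hc' : (n : ℝ) * rateG η ≤ n * M + (2 * π - δ) * |y| :=
    calc (n : ℝ) * rateG η = n * (rateG η - (2 * π - δ) * |η|) + (2 * π - δ) * (n * |η|) := by ring
      _ ≤ n * M + (2 * π - δ) * (n * |η|) := by gcongr
      _ = n * M + (2 * π - δ) * |y| := by rw [habs]
  -- (y/n)² ≤ y²
  have hlog : Real.log (22 ^ 2 + η ^ 2) ≤ Real.log (484 + y ^ 2) := by
    apply Real.log_le_log (by positivity)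
    have : η ^ 2 ≤ y ^ 2 := by
      rw [hη, div_pow]; exact div_le_self (sq_nonneg y) (by nlinarith)
    nlinarith
  -- log of the numerator
  have hlogR : Real.log ‖ratRC n ((uLine n : ℂ) + (y : ℂ) * I)‖ ≤
      n * M + (2 * π - δ) * |y| + 2 * Real.log n + 9 * Real.log (484 + y ^ 2) + K0 := by
    refine hL.trans ?_
    unfold K0
    have h9 := mul_le_mul_of_nonneg_left hlog (by norm_num : (0:ℝ) ≤ 9)
    exact add_le_add (add_le_add (add_le_add hc' le_rfl) h9) le_rfl
  have hR : ‖ratRC n ((uLine n : ℂ) + (y : ℂ) * I)‖ ≤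
      Real.exp (n * M + (2 * π - δ) * |y| + 2 * Real.log n + 9 * Real.log (484 + y ^ 2) + K0) := by
    rcases eq_or_lt_of_le (norm_nonneg (ratRC n ((uLine n : ℂ) + (y : ℂ) * I))) with h0 | hpos
    · rw [← h0]; exact (Real.exp_pos _).le
    · exact (Real.log_le_iff_le_exp hpos).1 hlogR
  -- the kernel
  have hK : Real.exp (2 * |π * y|) / 4 ≤ Real.cosh (π * y) ^ 2 := exp_le_cosh_sq _
  have hcosh : 0 < Real.cosh (π * y) ^ 2 := by positivity
  rw [div_le_iff₀ hcosh]
  have hpy : |π * y| = π * |y| := by rw [abs_mul, abs_of_pos Real.pi_pos]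
  rw [hpy] at hK
  -- rewrite the target's right-hand side as an exponential times cosh²-lower-bound
  have hexp : Real.exp (n * M + (2 * π - δ) * |y| + 2 * Real.log n + 9 * Real.log (484 + y ^ 2) + K0) =
      Real.exp K0 * (n : ℝ) ^ 2 * (484 + y ^ 2) ^ 9 * Real.exp (n * M) * Real.exp (-(δ * |y|))
        * (Real.exp (2 * (π * |y|)) / 4) * 4 := by
    have h484 : (0 : ℝ) < 484 + y ^ 2 := by positivity
    rw [show n * M + (2 * π - δ) * |y| + 2 * Real.log n + 9 * Real.log (484 + y ^ 2) + K0 =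
      K0 + 2 * Real.log n + 9 * Real.log (484 + y ^ 2) + n * M + (-(δ * |y|)) + 2 * (π * |y|) by ring]
    rw [Real.exp_add, Real.exp_add, Real.exp_add, Real.exp_add, Real.exp_add]
    rw [show (2 : ℝ) * Real.log n = Real.log ((n : ℝ) ^ 2) by rw [Real.log_pow]; push_cast; ring,
      Real.exp_log (by positivity),
      show (9 : ℝ) * Real.log (484 + y ^ 2) = Real.log ((484 + y ^ 2) ^ 9) by rw [Real.log_pow]; push_cast; ring,
      Real.exp_log (by positivity)]
    ring
  calc ‖ratRC n ((uLine n : ℂ) + (y : ℂ) * I)‖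
      ≤ Real.exp K0 * (n : ℝ) ^ 2 * (484 + y ^ 2) ^ 9 * Real.exp (n * M) * Real.exp (-(δ * |y|))
          * (Real.exp (2 * (π * |y|)) / 4) * 4 := by rw [← hexp]; exact hR
    _ ≤ Real.exp K0 * (n : ℝ) ^ 2 * (484 + y ^ 2) ^ 9 * Real.exp (n * M) * Real.exp (-(δ * |y|))
          * Real.cosh (π * y) ^ 2 * 4 := by gcongr
    _ = 4 * Real.exp K0 * (n : ℝ) ^ 2 * (484 + y ^ 2) ^ 9 * Real.exp (n * M) * Real.exp (-(δ * |y|))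
          * Real.cosh (π * y) ^ 2 := by ring

/-! ### The dominating function is integrable -/

/-- `(484 + y²)⁹ ≤ (22 + |y|)¹⁸`. -/
theorem poly_le_pow (y : ℝ) : (484 + y ^ 2) ^ 9 ≤ (22 + |y|) ^ 18 := by
  have h : 484 + y ^ 2 ≤ (22 + |y|) ^ 2 := by nlinarith [abs_nonneg y, sq_abs y]
  calc (484 + y ^ 2) ^ 9 ≤ ((22 + |y|) ^ 2) ^ 9 := pow_le_pow_left₀ (by positivity) h 9
    _ = (22 + |y|) ^ 18 := by ring

/-- `(22 + |y|)¹⁸ ≤ 18!·(2/δ)¹⁸·e^{(δ/2)(22+|y|)}` (`δ > 0`). -/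
theorem pow_le_exp (hδ : 0 < δ) (y : ℝ) :
    (22 + |y|) ^ 18 ≤ (Nat.factorial 18 : ℝ) * (2 / δ) ^ 18 * Real.exp (δ / 2 * (22 + |y|)) := by
  have hx : 0 ≤ δ / 2 * (22 + |y|) := by positivity
  have h := Real.pow_div_factorial_le_exp _ hx 18
  have hf : (0 : ℝ) < Nat.factorial 18 := by exact_mod_cast Nat.factorial_pos 18
  rw [div_le_iff₀ hf] at h
  have e : (22 + |y|) ^ 18 = (2 / δ) ^ 18 * (δ / 2 * (22 + |y|)) ^ 18 := by
    rw [← mul_pow]; congr 1; field_simp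
  rw [e]
  have h2 : 0 ≤ (2 / δ) ^ 18 := by positivity
  nlinarith [h, h2]

/-- `e^{−b|y|}` is integrable on `ℝ` (`b > 0`). -/
theorem integrable_exp_neg_mul_abs {b : ℝ} (hb : 0 < b) : Integrable (fun y : ℝ => Real.exp (-(b * |y|))) := by
  have h1 : IntegrableOn (fun y : ℝ => Real.exp (-(b * |y|))) (Ioi 0) := by
    refine (exp_neg_integrableOn_Ioi 0 hb).congr_fun (fun y hy => ?_) measurableSet_Ioi
    rw [mem_Ioi] at hy
    rw [abs_of_pos hy]; ring_nf
  have h2 : IntegrableOn (fun y : ℝ => Real.exp (-(b * |y|))) (Iic 0) := by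
    refine (integrableOn_exp_mul_Iic hb 0).congr_fun (fun y hy => ?_) measurableSet_Iic
    rw [mem_Iic] at hy
    rw [abs_of_nonpos hy]; ring_nf
  have h := h2.union h1
  rwa [Iic_union_Ioi, integrableOn_univ] at h

/-- The dominating function `(484+y²)⁹ e^{−δ|y|}` is integrable (`δ > 0`). -/
theorem integrable_poly_exp (hδ : 0 < δ) :
    Integrable (fun y : ℝ => (484 + y ^ 2) ^ 9 * Real.exp (-(δ * |y|))) := by
  set C : ℝ := (Nat.factorial 18 : ℝ) * (2 / δ) ^ 18 * Real.exp (11 * δ) with hC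
  have hdom : ∀ y : ℝ, (484 + y ^ 2) ^ 9 * Real.exp (-(δ * |y|)) ≤ C * Real.exp (-(δ / 2 * |y|)) := by
    intro y
    have h1 := (poly_le_pow y).trans (pow_le_exp hδ y)
    have he : (Nat.factorial 18 : ℝ) * (2 / δ) ^ 18 * Real.exp (δ / 2 * (22 + |y|)) * Real.exp (-(δ * |y|)) =
        C * Real.exp (-(δ / 2 * |y|)) := by
      rw [hC, mul_assoc, ← Real.exp_add, mul_assoc ((Nat.factorial 18 : ℝ) * (2 / δ) ^ 18), ← Real.exp_add]
      congr 2; ring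
    rw [← he]
    exact mul_le_mul_of_nonneg_right h1 (Real.exp_pos _).le
  refine Integrable.mono' ((integrable_exp_neg_mul_abs (by positivity : 0 < δ / 2)).const_mul C) ?_ ?_
  · exact (by fun_prop : Continuous fun y : ℝ => (484 + y ^ 2) ^ 9 * Real.exp (-(δ * |y|))).aestronglyMeasurable
  · refine Filter.Eventually.of_forall fun y => ?_
    rw [Real.norm_eq_abs, abs_of_nonneg (by positivity)]
    exact hdom y

/-! ### The half-line bound and `Decay` -/

/-- The integral of the majorant: `∫ F_n ≤ 4e^{K₀} n² e^{nM} · ∫ (484+y²)⁹e^{−δ|y|}`. -/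
theorem integral_lineIntegrand_le (hδ : 0 < δ) (hcert : ∀ η : ℝ, η ≠ 0 → rateG η - (2 * π - δ) * |η| ≤ M) {n : ℕ}
    (hn : 1 ≤ n) :
    ∫ y : ℝ, ‖ratRC n ((uLine n : ℂ) + (y : ℂ) * I)‖ / Real.cosh (π * y) ^ 2 ≤
      4 * Real.exp K0 * (n : ℝ) ^ 2 * Real.exp (n * M) * ∫ y : ℝ, (484 + y ^ 2) ^ 9 * Real.exp (-(δ * |y|)) := by
  rw [← integral_const_mul]
  refine integral_mono_of_nonneg (Filter.Eventually.of_forall fun y => by positivity)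
    ((integrable_poly_exp hδ).const_mul _) ?_
  have h0 : ∀ᵐ y : ℝ ∂volume, y ≠ 0 := by
    have : (volume : Measure ℝ) {0} = 0 := measure_singleton 0
    filter_upwards [measure_eq_zero_iff_ae_notMem.1 this] with y hy
    simpa using hy
  filter_upwards [h0] with y hy
  have := lineIntegrand_le hcert hn hy
  calc ‖ratRC n ((uLine n : ℂ) + (y : ℂ) * I)‖ / Real.cosh (π * y) ^ 2
      ≤ 4 * Real.exp K0 * (n : ℝ) ^ 2 * (484 + y ^ 2) ^ 9 * Real.exp (n * M) * Real.exp (-(δ * |y|)) := this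
    _ = 4 * Real.exp K0 * (n : ℝ) ^ 2 * Real.exp (n * M) * ((484 + y ^ 2) ^ 9 * Real.exp (-(δ * |y|))) := by ring

/-- `n² ≤ (8/ε²)·e^{εn/2}` (`ε > 0`). -/
theorem sq_le_exp {ε : ℝ} (hε : 0 < ε) (n : ℕ) : (n : ℝ) ^ 2 ≤ 8 / ε ^ 2 * Real.exp (ε / 2 * n) := by
  have hx : 0 ≤ ε / 2 * n := by positivity
  have h := Real.pow_div_factorial_le_exp _ hx 2
  simp only [Nat.factorial_two, Nat.cast_ofNat] at h
  rw [div_le_iff₀ (by norm_num : (0:ℝ) < 2)] at h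
  have hε2 : 0 < ε ^ 2 := by positivity
  rw [div_mul_eq_mul_div, le_div_iff₀ hε2]
  nlinarith [h]

/-- **`Decay c` from the certificate** [P15KERNEL §6, E5 reduced to its one-variable inequality]: if for some `δ > 0`
and `M` the explicit rate function satisfies `rateG η − (2π − δ)|η| ≤ M` for all `η ≠ 0`, then `Decay c` holds for every
`c < −M`. -/
theorem decay_of_certificate (hδ : 0 < δ) (hcert : ∀ η : ℝ, η ≠ 0 → rateG η - (2 * π - δ) * |η| ≤ M) {c : ℝ}
    (hc : c < -M) : Denom.TwoTaleP15Forms.Decay c := by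
  refine Denom.TwoTaleP15LineRep.decay_of_halfLineBound xLine (fun n => by unfold xLine; omega) ?_
  set ε : ℝ := -M - c with hεdef
  have hε : 0 < ε := by rw [hεdef]; linarith
  set A : ℝ := 4 * Real.exp K0 * ∫ y : ℝ, (484 + y ^ 2) ^ 9 * Real.exp (-(δ * |y|)) with hA
  have hA0 : 0 ≤ A := by
    rw [hA]; exact mul_nonneg (by positivity) (integral_nonneg fun y => by positivity)
  -- eventually: (π/2)·A·(8/ε²)·e^{εn/2} ≤ e^{εn/2}·e^{εn/2}
  have hev : ∀ᶠ n : ℕ in atTop, π / 2 * A * (8 / ε ^ 2) ≤ Real.exp (ε / 2 * n) := by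
    have ht : Tendsto (fun n : ℕ => Real.exp (ε / 2 * n)) atTop atTop :=
      Real.tendsto_exp_atTop.comp (tendsto_natCast_atTop_atTop.const_mul_atTop (by positivity))
    exact ht.eventually_ge_atTop _
  have hev1 : ∀ᶠ n : ℕ in atTop, 1 ≤ n := Filter.eventually_ge_atTop 1
  filter_upwards [hev, hev1] with n hK hn1
  have hn0 : (0 : ℝ) < n := by exact_mod_cast hn1
  -- rewrite the integrand's argument to `uLine n + y I`
  have harg : ∀ y : ℝ, ((((xLine n : ℝ) + 1 / 2 : ℝ) : ℂ) - (11 * n + 1) + (y : ℂ) * I) =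
      ((uLine n : ℂ) + (y : ℂ) * I) := fun y => by unfold uLine; push_cast; ring
  simp_rw [harg]
  have hI := integral_lineIntegrand_le hδ hcert hn1
  have hsq := sq_le_exp hε n
  have hpi : 0 < π / 2 := by positivity
  calc π / 2 * ∫ y : ℝ, ‖ratRC n ((uLine n : ℂ) + (y : ℂ) * I)‖ / Real.cosh (π * y) ^ 2
      ≤ π / 2 * (4 * Real.exp K0 * (n : ℝ) ^ 2 * Real.exp (n * M) *
          ∫ y : ℝ, (484 + y ^ 2) ^ 9 * Real.exp (-(δ * |y|))) := mul_le_mul_of_nonneg_left hI hpi.le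
    _ = π / 2 * A * (n : ℝ) ^ 2 * Real.exp (n * M) := by rw [hA]; ring
    _ ≤ π / 2 * A * (8 / ε ^ 2 * Real.exp (ε / 2 * n)) * Real.exp (n * M) := by gcongr
    _ = (π / 2 * A * (8 / ε ^ 2)) * Real.exp (ε / 2 * n) * Real.exp (n * M) := by ring
    _ ≤ Real.exp (ε / 2 * n) * Real.exp (ε / 2 * n) * Real.exp (n * M) := by gcongr
    _ = Real.exp (-(c * n)) := by
        rw [← Real.exp_add, ← Real.exp_add]; congr 1; rw [hεdef]; ring

end Summit.KontsevichZagierPeriods.Zeta5Search.TwoTaleLineBound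

end
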